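/-
Copyright: statement-level skeleton of a published paper (lit-balaban cell, Phase-2 proof seat p18, gen 7). No claims beyond
what the kernel checks below.
-/
import Mathlib
import Literature.MathematicalPhysics.QuantumFieldTheory.Balaban1983to89.B3FreeLineIBP

/-!
# B3 — T. Bałaban, *(Higgs)₂,₃ quantum fields in a finite volume. III. Renormalization*, CMP **88** (1983) 411–445
[Balaban1983Higgs3] — **Proposition 2.2** p. 428 (Proposition 2.1 WITH the (2.4) exception for the generalized expressions
and graphs): r15's `B3Prop1.Prop22` INHABITED for the family of multi-graph expansions of the IBP-ready amplitudes over the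
generalized graphs with free line exponents from a finite menu

statement-level skeleton of published theorems with citation tags; proofs where landed; nothing here is a claim about
the Yang–Mills mass gap

PDF held: `paper:balaban1983-higgs-2-3-quantum-fields-finite-volume` (journal page = PDF page + 410); p. 428 [PDF 18] read on
the materialised text.

Part of the Phase-2 work on SKELETON row **B3.Prop2.2** (unit `lit-balaban-p18` gen 7, HOME `run/shared/lean/pub/lit-balaban/`;
the fold owner's closing item of ROWS-B3 v1.53 «free line exponent κ_l»): files `B3FreeLineDegrees` → `B3FreeLineAmplitude` →
`B3FreeLineIBP` → `B3Prop22FreeLines` (this file); the κ ≡ 0 slice of the family is seat p19's `famIBP` of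
`B3Prop21Except24Family` (`prop22_except24`, p264421), whose proof is followed line by line.

WHAT IS REPRODUCED.  **Proposition 2.2** p. 428 [PDF 18], verbatim (with the sentences it refers to): *"It is easily seen
from the proof that the theorem can be generalized to a much wider class of graphs and expressions. We can have vertices with
an arbitrary number of legs and arbitrary power of η. We can have lines with the same exponential factors but with arbitrary
dimensions instead of −d+2. The only thing which matters is that propagators have representations corresponding to (2.6)
with the estimates corresponding to (2.10)–(2.12), so that we have the inequality (2.13) with the proper generalization of
(2.14). We can formulate these remarks as the theorem: Proposition 2.2. Proposition 2.1 holds for the described above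
generalized expressions and graphs."*, Proposition 2.1 p. 424: *"Let G be a connected graph such that its each connected
subgraph, with the possible exception of the subgraphs (2.4), has a positive degree. Then we define G_ren = {G} and
Proposition 1 holds in this case."*, and (2.16) p. 428: *"O(1) depends on δ_i, n̄ only"*.  KERNEL-CHECKED HERE:
**`prop22_freeLines : B3Prop1.Prop22 (famK P mbar)`** (and `prop21_freeLines`) for the family of MULTI-GRAPH EXPANSIONS
`expansionK P mb D` of r15's carrier — graphs = the GENERALIZED GRAPHS `CGraphK P mb`: a connected count datum on `Fin n` with
at most `mb = mbar n̄` lines (vertices with arbitrary numbers of legs, differentiations, averaged legs and η-powers — seat p19's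
`Counts`) TOGETHER WITH an extra dimension `κ_l` per line taken from the finite menu `P.menu ⊂ ℚ` (the line `l` has dimension
`−(d−2)·(legs)/2 − diffs + avgs + κ_l`, `Counts.toModelK`); analytic datum `D : DatumK P` = `k`, the running couplings, and
for every generalized graph AND localization `{□(v)}` an IBP-ready amplitude over it (`IBPAmpK`: the propagator
representation (2.6) with the estimates (2.10)–(2.12) at the generalized dimensions and their derivative budget, constants
`≤ Cmax`, `cD ≤ CD`); `E(G, {□(v)}, Φ, A)` = its total amplitude `Amp.EtotM`; connected subgraphs = the components of the
`G_i` along every ordering with their ℚ-valued degrees `degQK` (= (2.2) with the generalized line dimensions); **`Is24 :=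
Is24K`** (a (2.4)-block whose line is a standard one): δ₀ := ½δ₁ first; given α₀, n̄ ONE constant `O(1)(n̄) = unifO1K P (mbar
n̄)` (a function of `n̄`, `d`, `L`, `δ₁`, `Cmax`, `CD` and the menu only); then for every datum and every generalized graph
satisfying the PRINTED hypothesis `PosSubgraphsExcept24`, (1.33) for all localizations — via `IBPAmpK.abs_EtotM_le` ((2.6),
(2.7), the integration by parts (2.8)/(2.9) at the (2.4)-blocks, (2.13), (2.15) with the uniform constant of
`B3FreeLineDegrees.const215K_le`).  NON-VACUITY: the index type is inhabited (`DatumK.zero`), and for `0 ∈ P.menu` every graph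
of p19's family `CGraphC` is the κ ≡ 0 member `CGraphK.ofC` of this one.  HONEST SCOPE: (i) the analytic inputs ((2.5),
(2.10)–(2.12) at the generalized dimensions, their derivative budget, the IBP-readiness, the face-vanishing localization) are
hypotheses (fields) of the class `IBPAmpK`, as in p19's files and as the print's own forward references; (ii) "arbitrary
dimensions" is read as "dimensions shifted by exponents from any fixed finite set `P.menu ⊂ ℚ`" — a parameter of the family
like `Cmax`: with unrestricted dimensions no single O(1) exists (the sum (2.15) diverges as a block degree tends to 0), and
r15's carrier degrees are ℚ-valued; Sect. 3 of the paper uses the shifts `1 + α`, `α` of (3.12)–(3.14).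
-/

open Finset

namespace Literature.MathematicalPhysics.QuantumFieldTheory.Balaban1983to89

namespace B3FreeLine

open B3Ineq215 B3Ineq213 B3Sect2FirstEstimate B3Prop1

variable {V : Type} [Fintype V] [DecidableEq V] {m : ℕ}

/-! ## The family of generalized graph expansions -/

/-- The constants of the family: those of p19's `ParamsIBP` (`d`, `L`, `δ₁`, `Cmax`, `CD`) and the finite MENU of extra line
dimensions (*"lines … with arbitrary dimensions instead of −d+2"* — any fixed finite set of them). [cite: Balaban1983Higgs3, Prop. 2.2 p.428] -/
structure ParamsK extends ParamsIBP where
  /-- the finite set of admissible extra line exponents `κ_l` -/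
  menu : Finset ℚ

/-- **The generalized graphs of Proposition 2.2** at the size bound `mb`: a CONNECTED count datum on `Fin n` with `m ≤ mb` lines
and the lattice constants of `P` (p19's `CGraphC`: vertices with arbitrary numbers of legs and powers of η) together with an
extra dimension `κ_l ∈ P.menu` for every line. [cite: Balaban1983Higgs3, Prop. 2.2 p.428] -/
structure CGraphK (P : ParamsK) (mb : ℕ) extends CGraphC P.toParams mb where
  /-- the extra line exponents -/
  κ : Fin m → ℚ
  /-- taken from the menu -/
  κ_mem : ∀ l, κ l ∈ P.menu

/-- For `0 ∈ menu`, every graph of p19's family (standard line dimensions) is a generalized graph with `κ ≡ 0`.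
[cite: Balaban1983Higgs3, Prop. 2.2 p.428] -/
def CGraphK.ofC {P : ParamsK} {mb : ℕ} (G : CGraphC P.toParams mb) (h0 : (0 : ℚ) ∈ P.menu) : CGraphK P mb where
  toCGraphC := G
  κ := fun _ => 0
  κ_mem := fun _ => h0

/-- The analytic datum of one expansion: the number `k` of completed steps, the running couplings, and for every generalized
graph (connected count datum + menu-valued extra exponents) AND localization `{□(v)}` the IBP-ready localized lattice graph
amplitude over it (constants `≤ Cmax`, `cD ≤ CD`; the orders do not depend on the localization).
[cite: Balaban1983Higgs3, Prop. 2.2 p.428] -/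
structure DatumK (P : ParamsK) where
  /-- number of completed renormalization steps -/
  k : ℕ
  /-- `e(L^kε)` -/
  eRun : ℝ
  /-- `λ(L^kε)` -/
  lamRun : ℝ
  eRun_pos : 0 < eRun
  lamRun_pos : 0 < lamRun
  /-- the amplitude of each generalized graph at each localization -/
  amp : ∀ {n m : ℕ} (G : Counts (Fin n) m) (κ : Fin m → ℚ), (∀ l, κ l ∈ P.menu) → LinesConnect G.src G.tgt →
    (Fin n → Fin (G.toModelK κ).d → ℕ) → IBPAmpK G κ
  amp_k : ∀ {n m : ℕ} (G : Counts (Fin n) m) (κ : Fin m → ℚ) (hκ : ∀ l, κ l ∈ P.menu) (hG : LinesConnect G.src G.tgt)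
    (box : Fin n → Fin (G.toModelK κ).d → ℕ), (amp G κ hκ hG box).k = k
  amp_box : ∀ {n m : ℕ} (G : Counts (Fin n) m) (κ : Fin m → ℚ) (hκ : ∀ l, κ l ∈ P.menu) (hG : LinesConnect G.src G.tgt)
    (box : Fin n → Fin (G.toModelK κ).d → ℕ), (amp G κ hκ hG box).box = box
  amp_eRun : ∀ {n m : ℕ} (G : Counts (Fin n) m) (κ : Fin m → ℚ) (hκ : ∀ l, κ l ∈ P.menu) (hG : LinesConnect G.src G.tgt)
    (box : Fin n → Fin (G.toModelK κ).d → ℕ), (amp G κ hκ hG box).eRun = eRun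
  amp_lamRun : ∀ {n m : ℕ} (G : Counts (Fin n) m) (κ : Fin m → ℚ) (hκ : ∀ l, κ l ∈ P.menu) (hG : LinesConnect G.src G.tgt)
    (box : Fin n → Fin (G.toModelK κ).d → ℕ), (amp G κ hκ hG box).lamRun = lamRun
  /-- the orders do not depend on the localization -/
  amp_dv : ∀ {n m : ℕ} (G : Counts (Fin n) m) (κ : Fin m → ℚ) (hκ : ∀ l, κ l ∈ P.menu) (hG : LinesConnect G.src G.tgt)
    (box box' : Fin n → Fin (G.toModelK κ).d → ℕ), (amp G κ hκ hG box).dv = (amp G κ hκ hG box').dv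
  amp_ds : ∀ {n m : ℕ} (G : Counts (Fin n) m) (κ : Fin m → ℚ) (hκ : ∀ l, κ l ∈ P.menu) (hG : LinesConnect G.src G.tgt)
    (box box' : Fin n → Fin (G.toModelK κ).d → ℕ), (amp G κ hκ hG box).ds = (amp G κ hκ hG box').ds
  /-- the constants O(1) of (2.10)–(2.12) are bounded by `Cmax` -/
  amp_C_le : ∀ {n m : ℕ} (G : Counts (Fin n) m) (κ : Fin m → ℚ) (hκ : ∀ l, κ l ∈ P.menu) (hG : LinesConnect G.src G.tgt)
    (box : Fin n → Fin (G.toModelK κ).d → ℕ) (l : Fin m), (amp G κ hκ hG box).C l ≤ P.Cmax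
  /-- the constants of the differentiated vertex bounds are bounded by `CD` -/
  amp_cD_le : ∀ {n m : ℕ} (G : Counts (Fin n) m) (κ : Fin m → ℚ) (hκ : ∀ l, κ l ∈ P.menu) (hG : LinesConnect G.src G.tgt)
    (box : Fin n → Fin (G.toModelK κ).d → ℕ), (amp G κ hκ hG box).cD ≤ P.CD

/-- **The multi-graph expansion of r15's carrier for the generalized graphs** (datum `D`, size bound `mb`): classes = graphs =
`CGraphK P mb`; `E({G}, {□(v)}, ·, ·)` = the total amplitude of the datum's amplitude of the generalized graph at `{□(v)}`;
`d({□(v)})` = `boxTreeLen`; norms `Π_v N^Φ_v`, `Π_v N^A_v`; orders `Σ_v d_v(v)`, `Σ_v d_s(v)`; connected subgraphs = the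
components of the `G_i` along every ordering (p19's `Component`) with the degrees `degQK` computed with the generalized line
dimensions; **`Is24 := Is24K`**. [cite: Balaban1983Higgs3, Prop. 2.2 p.428] -/
noncomputable def expansionK (P : ParamsK) (mb : ℕ) (D : DatumK P) : GraphExpansion where
  eRun := D.eRun
  lamRun := D.lamRun
  eRun_pos := D.eRun_pos
  lamRun_pos := D.lamRun_pos
  RenClass := CGraphK P mb
  Loc := fun G => Fin G.n → Fin (G.G.toModelK G.κ).d → ℕ
  ExtS := Unit
  ExtV := Unit
  E := fun G box _ _ => (D.amp G.G G.κ G.κ_mem G.conn box).toAmp.EtotM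
  ds := fun G => ∑ v, (D.amp G.G G.κ G.κ_mem G.conn box₀).ds v
  dv := fun G => ∑ v, (D.amp G.G G.κ G.κ_mem G.conn box₀).dv v
  treeLen := fun G box => boxTreeLen G.G.L D.k box
  treeLen_nonneg := fun G box => boxTreeLen_nonneg G.G.L D.k box
  normS := fun _ G box _ => ∏ v, (D.amp G.G G.κ G.κ_mem G.conn box).NPhi v
  normV := fun _ G box _ => ∏ v, (D.amp G.G G.κ G.κ_mem G.conn box).NA v
  normS_nonneg := fun _ G box _ => prod_nonneg fun v _ => (D.amp G.G G.κ G.κ_mem G.conn box).NPhi_nonneg v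
  normV_nonneg := fun _ G box _ => prod_nonneg fun v _ => (D.amp G.G G.κ G.κ_mem G.conn box).NA_nonneg v
  Graph := CGraphK P mb
  single := id
  Connected := fun _ => True
  Sub := fun G => Component G.G
  subDeg := fun G H => degQK (relabelCounts G.G H.1) (G.κ ∘ H.1) H.2.1 H.2.2.1
  Is24 := fun G H => Is24K (relabelCounts G.G H.1) (G.κ ∘ H.1) H.2.1 H.2.2.1

/-- The family `fam n̄ D` of r15's `Prop22`/`Prop21`: at level `n̄` the generalized graphs have at most `mbar n̄` lines.
[cite: Balaban1983Higgs3, Prop. 2.2 p.428] -/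
noncomputable def famK (P : ParamsK) (mbar : ℕ → ℕ) : ℕ → DatumK P → GraphExpansion :=
  fun nbar D => expansionK P (mbar nbar) D

/-- The printed hypothesis, read on the expansion: every component of every `G_i` along every ordering is a (2.4)-block of
the generalized graph or has positive (ℝ-valued) degree. [cite: Balaban1983Higgs3, Prop. 2.1 p.424] -/
theorem hyp_of_posSubgraphsExcept24K {P : ParamsK} {mb : ℕ} {D : DatumK P} {G : CGraphK P mb}
    (h : PosSubgraphsExcept24 (expansionK P mb D) G) (σ : Equiv.Perm (Fin G.m)) :
    ∀ i, i ≤ G.m → ∀ b ∈ ((relabelCounts G.G σ).toModelK (G.κ ∘ σ)).reps i,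
      ((relabelCounts G.G σ).toModelK (G.κ ∘ σ)).Nontriv i b →
      Is24K (relabelCounts G.G σ) (G.κ ∘ σ) i b ∨ 0 < ((relabelCounts G.G σ).toModelK (G.κ ∘ σ)).D i b := by
  intro i hi b hb hn
  rw [reps_toModelK] at hb
  rw [nontriv_toModelK] at hn
  have h' := h.2 ⟨σ, ⟨i, Nat.lt_succ_of_le hi⟩, ⟨b, hb, hn⟩⟩
  rcases h' with h24 | hpos
  · exact Or.inl h24
  · right
    have hc := cast_degQK (relabelCounts G.G σ) (G.κ ∘ σ) i b
    have : (0 : ℝ) < ((degQK (relabelCounts G.G σ) (G.κ ∘ σ) i b : ℚ) : ℝ) := by exact_mod_cast hpos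
    rw [hc] at this
    exact this

/-! ## Non-vacuity: the index type is inhabited -/

/-- **A datum exists** (for `Cmax ≥ 0`, `CD ≥ 1`): the zero amplitudes — the family `famK` is NOT vacuously indexed.
[cite: Balaban1983Higgs3, Prop. 2.2 p.428] -/
noncomputable def DatumK.zero (P : ParamsK) (hC : 0 ≤ P.Cmax) (hD : 1 ≤ P.CD) : DatumK P where
  k := 0
  eRun := 1
  lamRun := 1
  eRun_pos := one_pos
  lamRun_pos := one_pos
  amp := fun G κ _ hG box => IBPAmpK.zero G κ hG 0 box
  amp_k := fun _ _ _ _ _ => rfl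
  amp_box := fun _ _ _ _ _ => rfl
  amp_eRun := fun _ _ _ _ _ => rfl
  amp_lamRun := fun _ _ _ _ _ => rfl
  amp_dv := fun _ _ _ _ _ _ => rfl
  amp_ds := fun _ _ _ _ _ _ => rfl
  amp_C_le := fun _ _ _ _ _ _ => hC
  amp_cD_le := fun _ _ _ _ _ => hD

/-- The datum type is inhabited. [cite: Balaban1983Higgs3, Prop. 2.2 p.428] -/
theorem datumK_nonempty (P : ParamsK) (hC : 0 ≤ P.Cmax) (hD : 1 ≤ P.CD) : Nonempty (DatumK P) :=
  ⟨DatumK.zero P hC hD⟩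

/-! ## Proposition 2.2: Proposition 2.1 with the (2.4) exception for the generalized graphs, O(1) uniform -/

/-- The per-size term of the uniform constant: `m!·(m+1)^m·(|Cmax|(1+e^{δ₁})²)^m·unifConst215K(d, L, m, δ₁, Dmin menu m)·|CD|^m`.
[cite: Balaban1983Higgs3, (2.16) p.428] -/
noncomputable def sizeTermK (P : ParamsK) (m : ℕ) : ℝ :=
  (m.factorial : ℝ) * ((m + 1) ^ m : ℕ)
    * ((|P.Cmax| ^ m * ((1 + Real.exp (2 * (P.δ₁ / 2))) ^ 2) ^ m)
      * unifConst215K P.d P.L m P.δ₁ ((Dmin P.menu m : ℚ) : ℝ) * |P.CD| ^ m)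

/-- `sizeTermK ≥ 0`. [cite: Balaban1983Higgs3, (2.16) p.428] -/
theorem sizeTermK_nonneg (P : ParamsK) (m : ℕ) : 0 ≤ sizeTermK P m := by
  unfold sizeTermK
  have := (unifConst215K_pos P.d_pos P.two_le_L m P.δ₁_pos (show (0 : ℝ) < ((Dmin P.menu m : ℚ) : ℝ) by
    exact_mod_cast Dmin_pos P.menu m)).le
  positivity

/-- **The uniform constant O(1)(n̄)** at the size bound `mb`: `max 1 (Σ_{m ≤ mb} sizeTermK m)`. [cite: Balaban1983Higgs3, (2.16) p.428] -/
noncomputable def unifO1K (P : ParamsK) (mb : ℕ) : ℝ := max 1 (∑ m ∈ range (mb + 1), sizeTermK P m)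

/-- `unifO1K > 0`. [cite: Balaban1983Higgs3, (2.16) p.428] -/
theorem unifO1K_pos (P : ParamsK) (mb : ℕ) : 0 < unifO1K P mb := lt_max_of_lt_left one_pos

/-- Each size term is dominated by the uniform constant. [cite: Balaban1983Higgs3, (2.16) p.428] -/
theorem sizeTermK_le_unifO1K (P : ParamsK) {mb m : ℕ} (hm : m ≤ mb) : sizeTermK P m ≤ unifO1K P mb :=
  (single_le_sum (f := sizeTermK P) (fun m _ => sizeTermK_nonneg P m) (mem_range.2 (Nat.lt_succ_of_le hm))).trans
    (le_max_right _ _)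

/-- **Proposition 2.1 with the (2.4) exception for the generalized graphs — r15's `B3Prop1.Prop21` INHABITED for the
multi-graph expansions of the IBP-ready amplitudes over the generalized graphs with menu-valued free line exponents**: with
`δ₀ := ½δ₁` (first) and, given α₀ and n̄, the single constant `O(1)(n̄) := unifO1K P (mbar n̄)`, (1.33) holds for the class
`{G}` of EVERY generalized graph with at most `mbar n̄` lines all of whose components (of the `G_i`, every ordering) have
positive degree OR ARE (2.4)-BLOCKS, for every analytic datum, all localizations and all external-field data.
[cite: Balaban1983Higgs3, Prop. 2.2 p.428] -/
theorem prop21_freeLines (P : ParamsK) (mbar : ℕ → ℕ) : Prop21 (famK P mbar) := by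
  classical
  refine ⟨P.δ₁ / 2, half_pos P.δ₁_pos, fun α₀ _ _ nbar => ?_⟩
  refine ⟨unifO1K P (mbar nbar), unifO1K_pos P (mbar nbar), fun D G hG => ?_⟩
  intro box Φ Aext
  change Fin G.n → Fin (G.G.toModelK G.κ).d → ℕ at box
  set A : IBPAmpK G.G G.κ := D.amp G.G G.κ G.κ_mem G.conn box with hA
  have hyp := fun σ => hyp_of_posSubgraphsExcept24K hG σ
  have hmain := A.abs_EtotM_le G.κ_mem hyp
  -- the constants
  have hE : Esh (G.G.toModelK G.κ) = Real.exp (2 * (P.δ₁ / 2)) := by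
    show Real.exp (2 * (G.G.δ₁ / 2)) = _
    rw [G.δ₁_eq]
  have hC : ∏ l, A.C l ≤ |P.Cmax| ^ G.m := by
    calc ∏ l, A.C l ≤ ∏ _l : Fin G.m, |P.Cmax| :=
          prod_le_prod (fun l _ => A.C_nonneg l)
            fun l _ => (D.amp_C_le G.G G.κ G.κ_mem G.conn box l).trans (le_abs_self _)
      _ = |P.Cmax| ^ G.m := by rw [prod_const, card_univ, Fintype.card_fin]
  have hcD : A.cD ^ G.m ≤ |P.CD| ^ G.m :=
    pow_le_pow_left₀ (le_trans zero_le_one A.one_le_cD)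
      ((D.amp_cD_le G.G G.κ G.κ_mem G.conn box).trans (le_abs_self _)) _
  have hU0 : 0 ≤ unifConst215K P.d P.L G.m P.δ₁ ((Dmin P.menu G.m : ℚ) : ℝ) :=
    (unifConst215K_pos P.d_pos P.two_le_L G.m P.δ₁_pos (show (0 : ℝ) < ((Dmin P.menu G.m : ℚ) : ℝ) by
      exact_mod_cast Dmin_pos P.menu G.m)).le
  have hpref : 0 ≤ A.toAmp.prefM := A.toAmp.prefM_nonneg
  have hK : (G.m.factorial : ℝ) * ((G.m + 1) ^ G.m : ℕ)
      * (((∏ l, A.C l) * ((1 + Esh (G.G.toModelK G.κ)) ^ 2) ^ G.m)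
        * unifConst215K G.G.d G.G.L G.m G.G.δ₁ ((Dmin P.menu G.m : ℚ) : ℝ)
        * (A.cD ^ G.m * A.toAmp.prefM)) ≤ sizeTermK P G.m * A.toAmp.prefM := by
    rw [G.d_eq, G.L_eq, G.δ₁_eq, hE]
    unfold sizeTermK
    have h1 : (∏ l, A.C l) * ((1 + Real.exp (2 * (P.δ₁ / 2))) ^ 2) ^ G.m
        ≤ |P.Cmax| ^ G.m * ((1 + Real.exp (2 * (P.δ₁ / 2))) ^ 2) ^ G.m :=
      mul_le_mul_of_nonneg_right hC (pow_nonneg (sq_nonneg _) _)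
    have h2 : (∏ l, A.C l) * ((1 + Real.exp (2 * (P.δ₁ / 2))) ^ 2) ^ G.m
          * unifConst215K P.d P.L G.m P.δ₁ ((Dmin P.menu G.m : ℚ) : ℝ) * A.cD ^ G.m
        ≤ |P.Cmax| ^ G.m * ((1 + Real.exp (2 * (P.δ₁ / 2))) ^ 2) ^ G.m
          * unifConst215K P.d P.L G.m P.δ₁ ((Dmin P.menu G.m : ℚ) : ℝ) * |P.CD| ^ G.m :=
      mul_le_mul (mul_le_mul_of_nonneg_right h1 hU0) hcD (pow_nonneg (le_trans zero_le_one A.one_le_cD) _)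
        (mul_nonneg (mul_nonneg (pow_nonneg (abs_nonneg _) _) (pow_nonneg (sq_nonneg _) _)) hU0)
    have hf : 0 ≤ (G.m.factorial : ℝ) * ((G.m + 1) ^ G.m : ℕ) := by positivity
    calc (G.m.factorial : ℝ) * ((G.m + 1) ^ G.m : ℕ)
          * (((∏ l, A.C l) * ((1 + Real.exp (2 * (P.δ₁ / 2))) ^ 2) ^ G.m)
            * unifConst215K P.d P.L G.m P.δ₁ ((Dmin P.menu G.m : ℚ) : ℝ) * (A.cD ^ G.m * A.toAmp.prefM))
        = (G.m.factorial : ℝ) * ((G.m + 1) ^ G.m : ℕ)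
          * (((∏ l, A.C l) * ((1 + Real.exp (2 * (P.δ₁ / 2))) ^ 2) ^ G.m)
            * unifConst215K P.d P.L G.m P.δ₁ ((Dmin P.menu G.m : ℚ) : ℝ) * A.cD ^ G.m) * A.toAmp.prefM := by ring
      _ ≤ (G.m.factorial : ℝ) * ((G.m + 1) ^ G.m : ℕ)
          * (|P.Cmax| ^ G.m * ((1 + Real.exp (2 * (P.δ₁ / 2))) ^ 2) ^ G.m
            * unifConst215K P.d P.L G.m P.δ₁ ((Dmin P.menu G.m : ℚ) : ℝ) * |P.CD| ^ G.m) * A.toAmp.prefM :=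
          mul_le_mul_of_nonneg_right (mul_le_mul_of_nonneg_left h2 hf) hpref
      _ = _ := by ring
  have hfin : |A.toAmp.EtotM| ≤ unifO1K P (mbar nbar) * A.toAmp.prefM :=
    (hmain.trans hK).trans (mul_le_mul_of_nonneg_right (sizeTermK_le_unifO1K P G.m_le) hpref)
  -- assemble in the shape of `Ineq133At`
  show |A.toAmp.EtotM| ≤ unifO1K P (mbar nbar) * D.eRun ^ (∑ v, (D.amp G.G G.κ G.κ_mem G.conn box₀).dv v)
      * D.lamRun ^ (∑ v, (D.amp G.G G.κ G.κ_mem G.conn box₀).ds v) * Real.exp (-(P.δ₁ / 2 * boxTreeLen G.G.L D.k box))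
      * (∏ v, A.NPhi v) * (∏ v, A.NA v)
  have e : A.toAmp.prefM = D.eRun ^ (∑ v, (D.amp G.G G.κ G.κ_mem G.conn box₀).dv v)
      * D.lamRun ^ (∑ v, (D.amp G.G G.κ G.κ_mem G.conn box₀).ds v)
      * Real.exp (-(P.δ₁ / 2 * boxTreeLen G.G.L D.k box)) * (∏ v, A.NPhi v) * (∏ v, A.NA v) := by
    have hb : A.box = box := D.amp_box G.G G.κ G.κ_mem G.conn box
    have hk : A.k = D.k := D.amp_k G.G G.κ G.κ_mem G.conn box
    have he : A.eRun = D.eRun := D.amp_eRun G.G G.κ G.κ_mem G.conn box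
    have hl : A.lamRun = D.lamRun := D.amp_lamRun G.G G.κ G.κ_mem G.conn box
    have hdv : A.dv = (D.amp G.G G.κ G.κ_mem G.conn box₀).dv := D.amp_dv G.G G.κ G.κ_mem G.conn box box₀
    have hds : A.ds = (D.amp G.G G.κ G.κ_mem G.conn box₀).ds := D.amp_ds G.G G.κ G.κ_mem G.conn box box₀
    have hδ : (G.G.toModelK G.κ).δ₀ = G.G.δ₁ / 2 := rfl
    have hL : (G.G.toModelK G.κ).L = G.G.L := rfl
    unfold Amp.prefM
    rw [hb, hk, he, hl, hdv, hds, hδ, hL, G.δ₁_eq]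
  calc |A.toAmp.EtotM| ≤ unifO1K P (mbar nbar) * A.toAmp.prefM := hfin
    _ = _ := by rw [e]; ring

/-- **Proposition 2.2** p. 428 — r15's `B3Prop1.Prop22` INHABITED: Proposition 2.1 (with the (2.4) exception) holds for the
family of generalized expressions and graphs (vertices with arbitrary numbers of legs and powers of η, lines of arbitrary
menu-valued dimensions, propagators with (2.6) and (2.10)–(2.12)). [cite: Balaban1983Higgs3, Prop. 2.2 p.428] -/
theorem prop22_freeLines (P : ParamsK) (mbar : ℕ → ℕ) : Prop22 (famK P mbar) :=
  prop21_freeLines P mbar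

end B3FreeLine

end Literature.MathematicalPhysics.QuantumFieldTheory.Balaban1983to89
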